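import Summits.Langlands.Langlands.Theses.ResidualAvatarLadder

/-!
# Glue of the generation-1 split of `ResiduallyLieAutomorphy` (route ResidualAvatarLadder, rev 1)

Closes the glue item `stmt-Langlands-27950` of `route-Langlands-ResidualAvatarLadder`:
`ResiduallyLieAutomorphy_of_split : CoreIrreducibleAutomorphy → CoreReducibleAutomorphy →
ResiduallyLieAutomorphy`.
Pure logic — excluded middle on the (inlined) saturated residual-constituent dial: if the residual
representation becomes absolutely reducible over SOME finite solvable Galois `L/K`, the
core-reducible cell applies verbatim; otherwise every residual representation of `ρ|Γ_L` over every
finite solvable Galois `L/K` is absolutely irreducible and the core-irreducible cell applies.  This is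
the lens-1 node proof `CoreConstituentLadder.residuallyLie_of_cells` (decomp-langlands, 2026-08-30;
certified against a mock render in the node's kit check), transported to the tree's declarations.
No definitions, no new mathematics.
-/

set_option linter.dupNamespace false -- project-wide option; `Summit.Langlands.Langlands` is the mandated namespace

namespace Summit.Langlands.Langlands.Theorems

open Summit.Langlands.Langlands.Theses.ResidualAvatarLadder in
/-- The glue item `stmt-Langlands-27950` of route ResidualAvatarLadder (rev 1): the two children
`CoreIrreducibleAutomorphy` (cell `r = 1` of the residual-constituent grade) and
`CoreReducibleAutomorphy` (cell `r ≥ 2`) of the split of `ResiduallyLieAutomorphy` imply the parent.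
Proof: excluded middle on «`ρ̄` becomes absolutely reducible over some finite solvable Galois `L/K`»;
in the negative case the universally quantified absolute-irreducibility clause of the
core-irreducible cell is obtained by contraposition. -/
theorem ResiduallyLieAutomorphy_of_split_proof :
    Summit.Langlands.Langlands.Theses.ResidualAvatarLadder.ResiduallyLieAutomorphy_of_split := by
  intro hC hR K _ _ n hcpt hn ℓ _ ι ρ hirr hgeo htw hbox
  by_cases h : (∃ (L : Type) (_ : Field L) (_ : NumberField L) (_ : Algebra K L),
      IsGalois K L ∧ IsSolvable (L ≃ₐ[K] L) ∧
        ∃ σ : Field.absoluteGaloisGroup L →* GL (Fin n)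
            (Literature.NumberTheory.GaloisRepresentations.padicAlgClResidueField ℓ),
          (ρ.restrictField L).IsResidualRepOf (RingHom.id _) σ ∧
            ¬ Literature.NumberTheory.GaloisRepresentations.IsAbsIrreducible σ)
  · exact hR K n hcpt hn ℓ ι ρ hirr hgeo htw ⟨hbox, h⟩
  · refine hC K n hcpt hn ℓ ι ρ hirr hgeo htw ⟨hbox, ?_⟩
    intro L _ _ _ hgal hsolv σ hσ
    by_contra hred
    exact h ⟨L, inferInstance, inferInstance, inferInstance, hgal, hsolv, σ, hσ, hred⟩

end Summit.Langlands.Langlands.Theorems
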